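import Summits.KontsevichZagierPeriods.KontsevichZagierPeriods.Theorems.LinRedNormalFormArrangementNormalFormStubRebaseSimplePosJanus

/-!
# Stub `stub_rebaseSimplePos`, part `rebaseSimplePos_oneFibre` (crux `ArrangementNormalForm`,
line `janus-bands`, v6.2) — sub-part `Wedge`

Absolute convergence of Janus WEDGES by fibred-affine DOMINATION, uniformly in the silent base
coordinates (the any-dimension replacement of `RebaseOne.integrableOn_wedge`, whose constant
lower bound `mlo` on the distance to the letter has no uniform analogue over a base of dimension
`≥ 2`):
* `RebasePos.integrableOn_of_le_comp_pullInv` — if the per-fibre affine substitution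
  `Ψ = pullInv μ α δ` (`tᵢ = μᵢ sᵢ + αᵢ y + δᵢ(x')`, rule-2 data of part `Tools`) maps `W` into a
  set `D` on which `f` is absolutely integrable and `|f| ≤ C |f ∘ Ψ|` on `W`, then `f` is
  absolutely integrable on `W` (change of variables + domination);
* `RebasePos.integrableOn_wedge_near` — ONE lettered fibre `t` with bounds `θ < t < θ'` above
  its letter `c`, a level `κ` with `c < κ ≤ θ`: the lower wedge `W = {κ < t < θ}` converges
  absolutely as soon as, on the base cell, `λ (θ − κ) ≤ θ' − θ` for a rational `λ > 0` (the map
  `t ↦ θ + λ (t − κ)` sends `W` into `D`) and `θ' − c ≤ C (κ − c)` (the letter factor is dominated).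
  In the PINCH configuration of `stub_rebaseOne` (`θ = κ + A w`, `θ' = κ + B w`, `0 < A < B`) the
  first condition holds with `λ = (B − A)/A` and the second is the NEAR REGIME `B w ≤ (C−1)(κ − c)`;
  the complementary far regime `A w ≫ κ − c` (letter approaching the apex level) is NOT dominated
  (wedge mass `≍ log²`, band mass `≍ log`) and is the analytic residue of the one-fibre rebase.
  Registered as `rebaseSimplePos_wedgeNear` (literal text).

References: M. Kontsevich, D. Zagier, *Periods* (2001), §1.2, rules (1a), (2).
-/

noncomputable section

open Set MeasureTheory MvPolynomial
open Literature.NumberTheory.Transcendental Literature.ModelTheory.ExponentialFields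

namespace Summit.KontsevichZagierPeriods.ArrangementNormalForm.JanusBands

namespace RebasePos

open SeparatePos

section Dominated

variable {B K : ℕ}

/-- **Domination through a per-fibre affine substitution.** If `Ψ = pullInv μ α δ` (all
`μᵢ ≠ 0`) maps the semialgebraic set `W` into `D`, `f` is semialgebraic on `W`, absolutely
integrable on `D`, and `|f| ≤ C |f ∘ Ψ|` on `W`, then `f` is absolutely integrable on `W`. -/
theorem integrableOn_of_le_comp_pullInv (μ α : Fin K → ℚ) (δ : Fin K → (Fin B → ℚ) × ℚ)
    (hμ : ∀ i, μ i ≠ 0) {f : (Fin (B + 1 + K) → ℝ) → ℝ} {D W : Set (Fin (B + 1 + K) → ℝ)}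
    (hW : IsSemialgebraic ℚ W) (hf : IsSemialgebraicFunOn ℚ W f) (hfD : IntegrableOn f D)
    (hmaps : MapsTo (pullInv μ α δ) W D) (C : ℝ)
    (hle : ∀ w ∈ W, |f w| ≤ C * |f (pullInv μ α δ w)|) : IntegrableOn f W := by
  have hWm : MeasurableSet W := IsSemialgebraic.measurableSet_holds hW
  have h1 : IntegrableOn f (pullInv μ α δ '' W) := hfD.mono_set (mapsTo_iff_image_subset.1 hmaps)
  have h2 : IntegrableOn (fun w => |(pullLin μ α δ).det| • f (pullInv μ α δ w)) W :=
    (integrableOn_image_iff_integrableOn_abs_det_fderiv_smul volume hWm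
      (fun w _ => (hasFDerivAt_pullInv μ α δ w).hasFDerivWithinAt)
      (pullInv_injective μ α δ hμ).injOn f).1 h1
  have hdet : |(pullLin μ α δ).det| ≠ 0 := by
    rw [pullLin_det]
    exact abs_ne_zero.2 (Finset.prod_ne_zero_iff.2 fun i _ => by exact_mod_cast hμ i)
  have h3 : IntegrableOn (fun w => f (pullInv μ α δ w)) W := by
    refine IntegrableOn.congr_fun (h2.const_mul |(pullLin μ α δ).det|⁻¹) (fun w _ => ?_) hWm
    rw [smul_eq_mul, ← mul_assoc, inv_mul_cancel₀ hdet, one_mul]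
  refine Integrable.mono' (h3.norm.const_mul C) (KZ.aestronglyMeasurable_of_isSemialgebraicFunOn hf hWm) ?_
  filter_upwards [ae_restrict_mem hWm] with w hw
  rw [Real.norm_eq_abs, Real.norm_eq_abs]
  exact hle w hw

end Dominated

section Near

variable {B m m' : ℕ}

/-- Membership in a one-fibre literal domain with affine bounds. -/
theorem mem_gDom_one (M : Fin m' → (Fin (B + 1) → ℚ) × ℚ) (θ θ' : (Fin (B + 1) → ℚ) × ℚ)
    (z : Fin (B + 1 + 1) → ℝ) :
    z ∈ gDom B 1 m' M (fun _ => Sum.inr θ) (fun _ => Sum.inr θ') ↔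
      (∀ j, 0 < affF B 1 (M j) z) ∧ affF B 1 θ z < z (Fin.natAdd (B + 1) 0) ∧
        z (Fin.natAdd (B + 1) 0) < affF B 1 θ' z := by
  simp only [gDom, mem_setOf_eq, affF, Sum.elim_inr, Fin.forall_fin_one]

/-- The one-fibre literal integrand: base factor times the letter factor of the fibre. -/
theorem glit_one (p : MvPolynomial (Fin B) ℚ) (L : Fin m → (Fin B → ℚ) × ℚ) (e : Fin m → ℕ)
    (ℓ₁ ℓ₂ : (Fin B → ℚ) × ℚ) (n₁ n₂ : ℕ) (c : (Fin (B + 1) → ℚ) × ℚ) (z : Fin (B + 1 + 1) → ℝ) :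
    glit B 1 p L e ℓ₁ ℓ₂ n₁ n₂ (fun _ => some c) z =
      MvPolynomial.aeval (fun i => z (Fin.castAdd 1 (Fin.castSucc i))) p /
        (∏ j, (affB B 1 (L j) z) ^ e j) *
        ((z (Fin.castAdd 1 (Fin.last B)) - affB B 1 ℓ₁ z) ^ n₁ /
          (z (Fin.castAdd 1 (Fin.last B)) - affB B 1 ℓ₂ z) ^ n₂) *
        (1 / (z (Fin.natAdd (B + 1) 0) - affF B 1 c z)) := by
  rw [glit_eq]
  simp [fib, affF]

/-- A full-base affine form split into its `y`-part and its `x'`-part. -/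
theorem affF_split {K : ℕ} (c : (Fin (B + 1) → ℚ) × ℚ) (z : Fin (B + 1 + K) → ℝ) :
    affF B K c z = (c.1 (Fin.last B) : ℝ) * z (Fin.castAdd K (Fin.last B)) + affB B K (restr B c) z := by
  simp only [affF, affB, restr, Fin.sum_univ_castSucc]
  ring

/-- `affF` of the combination `θ − λ • κ`. -/
theorem affF_sub_smul {K : ℕ} (θ κ : (Fin (B + 1) → ℚ) × ℚ) (lam : ℚ) (z : Fin (B + 1 + K) → ℝ) :
    affF B K (θ - lam • κ) z = affF B K θ z - (lam : ℝ) * affF B K κ z := by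
  simp only [affF, Prod.fst_sub, Prod.snd_sub, Prod.smul_fst, Prod.smul_snd, Pi.sub_apply,
    Pi.smul_apply, smul_eq_mul, Rat.cast_sub, Rat.cast_mul, sub_mul, Finset.sum_sub_distrib,
    Finset.mul_sum, mul_add]
  ring

/-- **The lower wedge of one lettered fibre, near regime** (see the module docstring): with
`D = {θ < t < θ'}` the domain of `s` (literal, one fibre, letter `c`) and a level `κ` with
`c < κ ≤ θ`, `λ (θ − κ) ≤ θ' − θ` (`λ > 0` rational) and `θ' − c ≤ C (κ − c)` on the base cell, the
literal integrand is absolutely integrable on the wedge `W = {κ < t < θ}`: the substitution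
`t ↦ θ + λ (t − κ)` maps `W` into `D` and divides the letter factor by at most `C`. -/
theorem integrableOn_wedge_near (s : KZ.IntegralRep (B + 1 + 1)) (M : Fin m' → (Fin (B + 1) → ℚ) × ℚ)
    (p : MvPolynomial (Fin B) ℚ) (L : Fin m → (Fin B → ℚ) × ℚ) (e : Fin m → ℕ)
    (ℓ₁ ℓ₂ : (Fin B → ℚ) × ℚ) (n₁ n₂ : ℕ) (c θ θ' κ : (Fin (B + 1) → ℚ) × ℚ)
    (hdom : s.domain = gDom B 1 m' M (fun _ => Sum.inr θ) (fun _ => Sum.inr θ'))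
    (hint : EqOn s.integrand (glit B 1 p L e ℓ₁ ℓ₂ n₁ n₂ (fun _ => some c)) s.domain)
    (lam : ℚ) (C : ℝ) (hlam : 0 < lam)
    (hgeom : ∀ z : Fin (B + 1 + 1) → ℝ, (∀ j, 0 < affF B 1 (M j) z) →
      affF B 1 c z < affF B 1 κ z ∧ affF B 1 κ z ≤ affF B 1 θ z ∧
      (lam : ℝ) * (affF B 1 θ z - affF B 1 κ z) ≤ affF B 1 θ' z - affF B 1 θ z ∧
      affF B 1 θ' z - affF B 1 c z ≤ C * (affF B 1 κ z - affF B 1 c z)) :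
    IntegrableOn (glit B 1 p L e ℓ₁ ℓ₂ n₁ n₂ (fun _ => some c))
      (gDom B 1 m' M (fun _ => Sum.inr κ) (fun _ => Sum.inr θ)) := by
  set W := gDom B 1 m' M (fun _ => Sum.inr κ) (fun _ => Sum.inr θ) with hW
  set d : (Fin (B + 1) → ℚ) × ℚ := θ - lam • κ with hd
  set μ : Fin 1 → ℚ := fun _ => lam with hμ
  set α : Fin 1 → ℚ := fun _ => d.1 (Fin.last B) with hα
  set δ : Fin 1 → (Fin B → ℚ) × ℚ := fun _ => restr B d with hδ
  have hlam' : (0 : ℝ) < lam := by exact_mod_cast hlam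
  have hΨt : ∀ w, pullInv μ α δ w (Fin.natAdd (B + 1) 0) =
      (lam : ℝ) * w (Fin.natAdd (B + 1) 0) + (affF B 1 θ w - (lam : ℝ) * affF B 1 κ w) := by
    intro w
    rw [pullInv_fib, ← affF_sub_smul, affF_split d w, add_assoc]
  have hmaps : MapsTo (pullInv μ α δ) W s.domain := by
    intro w hw
    rw [hW, mem_gDom_one] at hw
    obtain ⟨hrow, h1, h2⟩ := hw
    obtain ⟨-, -, hlen, -⟩ := hgeom w hrow
    rw [hdom, mem_gDom_one]
    refine ⟨fun j => by rw [affF_pullInv]; exact hrow j, ?_, ?_⟩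
    · rw [affF_pullInv, hΨt]
      nlinarith
    · rw [affF_pullInv, hΨt]
      nlinarith
  have hfD : IntegrableOn (glit B 1 p L e ℓ₁ ℓ₂ n₁ n₂ (fun _ => some c)) s.domain :=
    s.integrableOn.congr_fun hint (KZ.IntegralRep.measurableSet_domain_holds s)
  refine integrableOn_of_le_comp_pullInv μ α δ (fun _ => hlam.ne') (isSemialgebraic_gDom _ _ _ _)
    (isSemialgebraicFunOn_glit (isSemialgebraic_gDom _ _ _ _) _ _ _ _ _ _ _ _) hfD hmaps C
    fun w hw => ?_
  rw [hW, mem_gDom_one] at hw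
  obtain ⟨hrow, h1, h2⟩ := hw
  obtain ⟨hcκ, hκθ, hlen, hC⟩ := hgeom w hrow
  rw [glit_one, glit_one]
  simp only [affB_pullInv, pullInv_base, affF_pullInv, hΨt]
  set G := MvPolynomial.aeval (fun i => w (Fin.castAdd 1 (Fin.castSucc i))) p /
      (∏ j, (affB B 1 (L j) w) ^ e j) *
      ((w (Fin.castAdd 1 (Fin.last B)) - affB B 1 ℓ₁ w) ^ n₁ /
        (w (Fin.castAdd 1 (Fin.last B)) - affB B 1 ℓ₂ w) ^ n₂) with hG
  set t := w (Fin.natAdd (B + 1) 0) with ht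
  have hpos : 0 < t - affF B 1 c w := by linarith
  have hpos' : 0 < (lam : ℝ) * t + (affF B 1 θ w - (lam : ℝ) * affF B 1 κ w) - affF B 1 c w := by
    nlinarith
  have hCpos : 0 < C := by
    by_contra hC0
    push Not at hC0
    nlinarith
  have hkey : (lam : ℝ) * t + (affF B 1 θ w - (lam : ℝ) * affF B 1 κ w) - affF B 1 c w ≤
      C * (t - affF B 1 c w) := by
    nlinarith
  have key : ∀ G a b' : ℝ, 0 < a → 0 < b' → b' ≤ C * a → |G * (1 / a)| ≤ C * |G * (1 / b')| := by
    intro G a b' ha hb' h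
    rw [abs_mul, abs_mul, abs_of_pos (one_div_pos.2 ha), abs_of_pos (one_div_pos.2 hb'),
      mul_left_comm]
    refine mul_le_mul_of_nonneg_left ?_ (abs_nonneg G)
    rw [mul_one_div, div_le_div_iff₀ ha hb', one_mul]
    exact h
  exact key G _ _ hpos hpos' hkey

end Near

end RebasePos

/-- **Registered part of `stub_rebaseSimplePos` / `rebaseSimplePos_oneFibre` (line `janus-bands`,
v6.2): the dominated (near-regime) Janus wedge of one lettered fibre, uniformly in the silent
base coordinates.** Literal one-fibre datum over a base of dimension `B + 1` with letter `c`,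
bounds `θ < t < θ'`, and a base level `κ` with, on the base cell, `c < κ ≤ θ`,
`λ (θ − κ) ≤ θ' − θ` (`λ > 0` rational) and `θ' − c ≤ C (κ − c)`: the literal integrand is
absolutely integrable on the wedge `{κ < t < θ}` (`RebasePos.integrableOn_wedge_near`:
rule-2 transport along `t ↦ θ + λ (t − κ)` and domination of the letter factor). This is the
convergence input of `RebasePos.janusExtendLo` in the near regime of a pinch; the far regime
(`θ − κ ≫ κ − c`) is not dominated. -/
theorem rebaseSimplePos_wedgeNear (B m m' n₁ n₂ : ℕ) (s : KZ.IntegralRep (B + 1 + 1)) (M : Fin m' → (Fin (B + 1) → ℚ) × ℚ) (L : Fin m → (Fin B → ℚ) × ℚ) (e : Fin m → ℕ) (p : MvPolynomial (Fin B) ℚ) (ℓ₁ ℓ₂ : (Fin B → ℚ) × ℚ) (c θ θ' κ : (Fin (B + 1) → ℚ) × ℚ) (lam : ℚ) (C : ℝ) (hlam : 0 < lam) (hdom : s.domain = {z | (∀ j, 0 < ∑ i, ((M j).1 i : ℝ) * z (Fin.castAdd 1 i) + ((M j).2 : ℝ)) ∧ ∀ i, Sum.elim (fun j => z (Fin.natAdd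 (B + 1) j)) (fun c => ∑ i', (c.1 i' : ℝ) * z (Fin.castAdd 1 i') + (c.2 : ℝ)) (Sum.inr θ : Fin 1 ⊕ ((Fin (B + 1) → ℚ) × ℚ)) < z (Fin.natAdd (B + 1) i) ∧ z (Fin.natAdd (B + 1) i) < Sum.elim (fun j => z (Fin.natAdd (B + 1) j)) (fun c => ∑ i', (c.1 i' : ℝ) * z (Fin.castAdd 1 i') + (c.2 : ℝ)) (Sum.inr θ' : Fin 1 ⊕ ((Fin (B + 1) → ℚ) × ℚ))}) (hint : EqOn s.integrand (fun z => MvPolynomial.aeval (fun i => z (Fin.castAdd 1 (Fin.castSucc i))) p / (∏ j, (∑ i, ((L j).1 i : ℝ) * z (Fin.castAdd 1 (Fin.castSucc i)) + ((L j).2 : ℝ)) ^ e j) * ((z (Fin.castAdd 1 (Fin.last B)) - (∑ i, (ℓ₁.1 i : ℝ) * z (Fin.castAdd 1 (Fin.castSucc i)) + (ℓ₁.2 : ℝ))) ^ n₁ / (z (Fin.castAdd 1 (Fin.last B)) - (∑ i, (ℓ₂.1 i : ℝ) * z (Fin.castAdd 1 (Fin.castSucc i)) + (ℓ₂.2 :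 ℝ))) ^ n₂) * ∏ i : Fin 1, (1 / (z (Fin.natAdd (B + 1) i) - (∑ i', (c.1 i' : ℝ) * z (Fin.castAdd 1 i') + (c.2 : ℝ))))) s.domain) (hgeom : ∀ z : Fin (B + 1 + 1) → ℝ, (∀ j, 0 < ∑ i, ((M j).1 i : ℝ) * z (Fin.castAdd 1 i) + ((M j).2 : ℝ)) → (∑ i, ((c).1 i : ℝ) * z (Fin.castAdd 1 i) + ((c).2 : ℝ)) < (∑ i, ((κ).1 i : ℝ) * z (Fin.castAdd 1 i) + ((κ).2 : ℝ)) ∧ (∑ i, ((κ).1 i : ℝ) * z (Fin.castAdd 1 i) + ((κ).2 : ℝ)) ≤ (∑ i, ((θ).1 i : ℝ) * z (Fin.castAdd 1 i) + ((θ).2 : ℝ)) ∧ (lam : ℝ) * ((∑ i, ((θ).1 i : ℝ) * z (Fin.castAdd 1 i) + ((θ).2 : ℝ)) - (∑ i, ((κ).1 i : ℝ) * z (Fin.castAdd 1 i) + ((κ).2 : ℝ))) ≤ (∑ i, ((θ').1 i : ℝ) * z (Fin.castAdd 1 i) + ((θ').2 : ℝ)) - (∑ i, ((θ).1 i : ℝ)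 * z (Fin.castAdd 1 i) + ((θ).2 : ℝ)) ∧ (∑ i, ((θ').1 i : ℝ) * z (Fin.castAdd 1 i) + ((θ').2 : ℝ)) - (∑ i, ((c).1 i : ℝ) * z (Fin.castAdd 1 i) + ((c).2 : ℝ)) ≤ C * ((∑ i, ((κ).1 i : ℝ) * z (Fin.castAdd 1 i) + ((κ).2 : ℝ)) - (∑ i, ((c).1 i : ℝ) * z (Fin.castAdd 1 i) + ((c).2 : ℝ)))) : IntegrableOn (fun z : Fin (B + 1 + 1) → ℝ => MvPolynomial.aeval (fun i => z (Fin.castAdd 1 (Fin.castSucc i))) p / (∏ j, (∑ i, ((L j).1 i : ℝ) * z (Fin.castAdd 1 (Fin.castSucc i)) + ((L j).2 : ℝ)) ^ e j) * ((z (Fin.castAdd 1 (Fin.last B)) - (∑ i, (ℓ₁.1 i : ℝ) * z (Fin.castAdd 1 (Fin.castSucc i)) + (ℓ₁.2 : ℝ))) ^ n₁ / (z (Fin.castAdd 1 (Fin.last B)) - (∑ i, (ℓ₂.1 i : ℝ) * z (Fin.castAdd 1 (Fin.castSucc i)) + (ℓ₂.2 : ℝ))) ^ n₂) * ∏ i :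 Fin 1, (1 / (z (Fin.natAdd (B + 1) i) - (∑ i', (c.1 i' : ℝ) * z (Fin.castAdd 1 i') + (c.2 : ℝ))))) {z | (∀ j, 0 < ∑ i, ((M j).1 i : ℝ) * z (Fin.castAdd 1 i) + ((M j).2 : ℝ)) ∧ ∀ i, Sum.elim (fun j => z (Fin.natAdd (B + 1) j)) (fun c => ∑ i', (c.1 i' : ℝ) * z (Fin.castAdd 1 i') + (c.2 : ℝ)) (Sum.inr κ : Fin 1 ⊕ ((Fin (B + 1) → ℚ) × ℚ)) < z (Fin.natAdd (B + 1) i) ∧ z (Fin.natAdd (B + 1) i) < Sum.elim (fun j => z (Fin.natAdd (B + 1) j)) (fun c => ∑ i', (c.1 i' : ℝ) * z (Fin.castAdd 1 i') + (c.2 : ℝ)) (Sum.inr θ : Fin 1 ⊕ ((Fin (B + 1) → ℚ) × ℚ))} :=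
  RebasePos.integrableOn_wedge_near s M p L e ℓ₁ ℓ₂ n₁ n₂ c θ θ' κ hdom hint lam C hlam hgeom


end Summit.KontsevichZagierPeriods.ArrangementNormalForm.JanusBands
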